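import Summits.QuantumFields.QCD.Theses.QuarksAsStableAction
import Literature.MathematicalPhysics.QuantumLattice.WilsonDiracAP

/-!
# Stub `stub_oddOfDiamagnetic` of line `Sketch` (idea `free-tangent-landau-chessboard`)
(crux `Summit.QuantumFields.QCD.Theses.QuarksAsStableAction.WilsonQuarkStability`, item stmt-QuantumFields-9736,
route route-QuantumFields-QuarksAsStableAction)

**The odd half of the crux from the diamagnetic inequality.**  Hypothesis `hD` is the diamagnetic inequality on
odd tori: `‖det D_W[V]‖ ≤ ‖det D_W[all-seams trivial field]‖` for every `U(3)` field `V` on `(ℤ/L)⁴`, `L` odd,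
`m > −1` (the composition of the other cycle-3 stubs of the line).  The conclusion is the crux
`QuarksAsStableAction.WilsonQuarkStability` VERBATIM with `Odd L →` inserted.

Proof (bookkeeping only): take `ε = 1/2`, `δ = 1`, `K = c₂ = C = 0`, `L₀ = 0`.  For `|m| ≤ 1/2` one has `−1 < m`;
the exponent is `0 + 0·S + 0·N = 0` and `exp 0 = 1`; the crux's `apDet U m` is `det D_W` of the seamed `U(3)`
lift of `U` (a `U(3)` field to which `hD` applies), and `apDet 1 m` is `det D_W` of the field
`e ↦ if e.1 e.2 = −1 then −⟨1, _⟩ else ⟨1, _⟩`, which is the all-seams trivial field of `hD` because the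
inclusion `SU(3) ↪ U(3)` maps `1` to `1`.

Pure theorem file (no `def`s, no Literature facts).
-/

namespace Summit.QuantumFields.QCD.Cruxes.WilsonQuarkStability.FreeTangentLandauChessboard

open Literature.MathematicalPhysics Literature.MathematicalPhysics.QuantumLattice
  Literature.MathematicalPhysics.QuantumFieldTheory
open Matrix Complex

noncomputable section

/-- **The odd half of the crux from the diamagnetic inequality** (stub `stub_oddOfDiamagnetic` of line `Sketch`):
if `‖det D_W[V]‖ ≤ ‖det D_W[all-seams trivial field]‖` for every `U(3)` field `V` on every odd torus and every
`m > −1`, then `QuarksAsStableAction.WilsonQuarkStability` holds on odd tori with `ε = 1/2`, `δ = 1`,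
`K = c₂ = C = 0`, `L₀ = 0`. -/
theorem stub_oddOfDiamagnetic
    (hD : ∀ (L : ℕ) [NeZero L], Odd L → ∀ (V : GaugeConfig 4 L (Matrix.unitaryGroup (Fin 3) ℂ)) (m : ℝ),
      -1 < m →
      ‖(wilsonDirac (unitaryFundamentalRep (Fin 3) ℂ) V m 1).det‖ ≤
        ‖(wilsonDirac (unitaryFundamentalRep (Fin 3) ℂ)
          (fun e : Edge 4 L => if e.1 e.2 = -1 then (-1 : Matrix.unitaryGroup (Fin 3) ℂ) else 1) m 1).det‖) :
    ∃ ε δ K c₂ C : ℝ, 0 < ε ∧ 0 < δ ∧ ∃ L₀ : ℕ, ∀ (L : ℕ) [NeZero L], L₀ ≤ L → Odd L → let apDet : Literature.MathematicalPhysics.QuantumFieldTheory.GaugeConfig 4 L (Matrix.specialUnitaryGroup (Fin 3) ℂ) → ℝ → ℂ := fun U m => Literature.MathematicalPhysics.QuantumLattice.fermionDet (Literature.MathematicalPhysics.QuantumLattice.wilsonDirac (Literature.MathematicalPhysics.QuantumLattice.unitaryFundamentalRep (Fin 3) ℂ) (fun e => if e.1 e.2 = -1 then -(⟨(U e).1,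 Matrix.specialUnitaryGroup_le_unitaryGroup (U e).2⟩ : Matrix.unitaryGroup (Fin 3) ℂ) else ⟨(U e).1, Matrix.specialUnitaryGroup_le_unitaryGroup (U e).2⟩) m 1); let dfc : Literature.MathematicalPhysics.QuantumFieldTheory.GaugeConfig 4 L (Matrix.specialUnitaryGroup (Fin 3) ℂ) → Literature.MathematicalPhysics.QuantumFieldTheory.Plaquette 4 L → ℝ := fun U p => 3 - (Literature.MathematicalPhysics.QuantumLattice.fundamentalRep (Fin 3) (Literature.MathematicalPhysics.QuantumFieldTheory.plaquetteHolonomy U p.1 p.2.1.1 p.2.1.2)).trace.re; ∀ m : ℝ, |m| ≤ ε → ∀ U : Literature.MathematicalPhysics.QuantumFieldTheory.GaugeConfig 4 L (Matrix.specialUnitaryGroup (Fin 3) ℂ), ‖apDet U m‖ ≤ Real.exp (K + c₂ * (∑ p ∈ Finset.univ.filter (fun p => dfc U p < δ), dfc U p) + C * ((Finset.univ.filter (fun p => δ ≤ dfc U p)).card : ℝ)) * ‖apDet 1 m‖ := by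
  refine ⟨1 / 2, 1, 0, 0, 0, by norm_num, by norm_num, 0, ?_⟩
  intro L _ _ hL apDet dfc m hm U
  have hm' : (-1 : ℝ) < m := by
    have h := (abs_le.1 hm).1
    linarith
  have hexp : Real.exp (0 + 0 * (∑ p ∈ Finset.univ.filter (fun p => dfc U p < 1), dfc U p) +
      0 * ((Finset.univ.filter (fun p => 1 ≤ dfc U p)).card : ℝ)) = 1 := by
    simp only [zero_mul, add_zero, Real.exp_zero]
  rw [hexp, one_mul]
  have hfield : (fun e : Edge 4 L => if e.1 e.2 = -1 then
      -(⟨((1 : GaugeConfig 4 L (Matrix.specialUnitaryGroup (Fin 3) ℂ)) e).1,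
          Matrix.specialUnitaryGroup_le_unitaryGroup
            ((1 : GaugeConfig 4 L (Matrix.specialUnitaryGroup (Fin 3) ℂ)) e).2⟩ :
          Matrix.unitaryGroup (Fin 3) ℂ)
      else ⟨((1 : GaugeConfig 4 L (Matrix.specialUnitaryGroup (Fin 3) ℂ)) e).1,
          Matrix.specialUnitaryGroup_le_unitaryGroup
            ((1 : GaugeConfig 4 L (Matrix.specialUnitaryGroup (Fin 3) ℂ)) e).2⟩) =
      (fun e : Edge 4 L => if e.1 e.2 = -1 then (-1 : Matrix.unitaryGroup (Fin 3) ℂ) else 1) := by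
    funext e
    split_ifs <;> rfl
  have h := hD L hL (fun e : Edge 4 L => if e.1 e.2 = -1 then
      -(⟨(U e).1, Matrix.specialUnitaryGroup_le_unitaryGroup (U e).2⟩ : Matrix.unitaryGroup (Fin 3) ℂ)
      else ⟨(U e).1, Matrix.specialUnitaryGroup_le_unitaryGroup (U e).2⟩) m hm'
  rw [← hfield] at h
  exact h

end

end Summit.QuantumFields.QCD.Cruxes.WilsonQuarkStability.FreeTangentLandauChessboard
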